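import Mathlib
import Summits.ResolutionOfSingularities.ResolutionOfSingularities.Theorems.RadicialJungCleanModelsCleanProp44ChartSigmaStep
import HarnessLib

/-!
# Route `RadicialJung`, crux `CleanModels` (stmt-ResolutionOfSingularities-15917), line `Sketch` rev 35, stub 6 `stub_cleanProp44` (X44c):
# THE CHART IDENTIFICATION (census (S2)) — THE LEVEL-`0` STOREY: blowing up the closed point `c` of a regular threefold germ and reading the next point on
# the strict transform of the leaf `L = V(t)`: `𝒪_{Z_0,z_1} = 𝒪′/(τ♯cᵢ, t′)` is a localization of `κ(c)[u]` — the START of the σ-tower invariant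

Seat decomp-res-hand-2 g22 (structural hand); companion of ✓ `exists_sigmaStep_of_isBlowup` (levels `≥ 1`).  Level `0` of the σ-tower of memo 4e §2.5 blows up the
POINT: centre `𝔪_c = (c 0, c 1, c 2) = (t, u₁, u₂)` (`n = 3`, `l = 0`), next point `z_1` on the strict transform of the leaf `V(t)` (`τ♯t ∈ (𝔪_c𝒪′)·𝔪′`); the chart
is `i ∈ {1, 2}` (`uᵢ`), `t′ = t/uᵢ ∈ 𝔪′`, and with the third index `i₂ ∉ {0, i}` the line `Z_0 = E_c ∩ L̃` has local ring `𝒪′/(τ♯cᵢ, t′)`, a localization of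
`κ(c)[u]` (`κ(c) = 𝒪_{X,c}/𝔪_c`, `u ↦ u_{i₂}/uᵢ`):

* `exists_pointStep_of_isBlowup` — chart index `i ≠ 0`, free index `i₂` (`i₂ ≠ 0`, `i₂ ≠ i`), `uf` with `τ♯c_k = τ♯cᵢ·uf_k`, `uf_i = 1`, `t′ := uf_0 ∈ 𝔪′`,
  `τ♯cᵢ` a non-zero-divisor (`hvnzd` at level `0`), `𝒪′/(τ♯cᵢ, t′)` local, and: if `κ(c) = 𝒪_{X,c}/(c)` is a localization of a base `K` at `M₀` (take `K = κ(c)`,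
  `M₀ =` the units), then for every `K[X]`-structure on `𝒪′/(τ♯cᵢ, t′)` with `C g ↦ class of g` and `X ↦ uf_{i₂}` it is a localization of `K[X]` at some submonoid
  (✓ `exists_chart_localization_of_isBlowup` (X) with `J = {t}`).

Chained with ✓ `exists_sigmaStep_of_isBlowup` (Z) along the levels (✓ `isLocalization_tower_of_bijective`) and (E) at the top, then ✓ `isLocalizationAtPrime_span_pair_of_mem`
/ ✓ `exists_prime_isLocalizationAtPrime_span` and ✓ `birth_descent_of_isLocalization` / ✓ `exists_successor_of_isLocalization`, this is census (S2) of the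
`δ`-descent.  Honest framing: OURS, instantiation only; nothing here proves X44c, any case of `CleanModels`, or resolution of singularities in characteristic `p`.
[cite: StacksProject, Tag 0804, Tag 0BIQ] [cite: CossartPiltant2008, Prop. 4.4 (proof, p. 11)] [cite: CossartJannsenSaito2020, Lemma 7.5]
-/

noncomputable section

set_option linter.dupNamespace false -- mandated namespace of this single-conjunct summit

open IsLocalRing CategoryTheory AlgebraicGeometry
open Literature.AlgebraicGeometry.Resolution

namespace Summit.ResolutionOfSingularities.ResolutionOfSingularities.Theorems.RadicialJung.CleanModels

universe u

variable {X X' : Scheme.{u}} {τ : X' ⟶ X} {J : X.IdealSheafData}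

/-- In `Fin 3`, off `0` and off `i ≠ 0` there is exactly one index. [folklore] -/
theorem fin_three_exists_third : ∀ i : Fin 3, i ≠ 0 → ∃ i₂ : Fin 3, i₂ ≠ 0 ∧ i₂ ≠ i ∧ ∀ j : Fin 3, j ≠ i → j ≠ 0 → j = i₂ := by
  decide

set_option maxHeartbeats 400000 in
-- long statement
/-- **THE LEVEL-`0` STOREY** (see the module docstring): point blow-up of a regular local ring of embedding dimension `3` (`(c 0, c 1, c 2)` a regular system of
parameters generating `J_x`), next point on the strict transform of `V(c 0)`. [cite: StacksProject, Tag 0804, Tag 0BIQ] [cite: CossartPiltant2008, Prop. 4.4 (proof, p. 11)] -/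
theorem exists_pointStep_of_isBlowup (hτ : IsBlowup τ J) (x' : X') (hR : IsRegularLocalRing (X.presheaf.stalk (τ x')))
    (c : Fin 3 → X.presheaf.stalk (τ x'))
    (hz : Ideal.span (Set.range (Fin.append c (Fin.elim0 : Fin 0 → X.presheaf.stalk (τ x')))) = maximalIdeal (X.presheaf.stalk (τ x')))
    (hdim : ringKrullDim (X.presheaf.stalk (τ x')) = ((3 + 0 : ℕ) : WithBot ℕ∞))
    (hcJ : Ideal.span (Set.range c) = stalkIdeal J (τ x'))
    (hL : (τ.stalkMap x').hom (c 0) ∈ (stalkIdeal J (τ x')).map (τ.stalkMap x').hom * maximalIdeal (X'.presheaf.stalk x'))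
    (hJ0 : (stalkIdeal J (τ x')).map (τ.stalkMap x').hom ≠ ⊥) :
    ∃ (i i₂ : Fin 3) (uf : Fin 3 → X'.presheaf.stalk x'), i ≠ 0 ∧ i₂ ≠ 0 ∧ i₂ ≠ i ∧
      (∀ k, (τ.stalkMap x').hom (c k) = (τ.stalkMap x').hom (c i) * uf k) ∧ uf i = 1 ∧ uf 0 ∈ maximalIdeal (X'.presheaf.stalk x') ∧
      (τ.stalkMap x').hom (c i) ∈ nonZeroDivisors (X'.presheaf.stalk x') ∧
      IsLocalRing (X'.presheaf.stalk x' ⧸ Ideal.span {(τ.stalkMap x').hom (c i), uf 0}) ∧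
      (∀ (K : Type u) [CommRing K] [Algebra K (X.presheaf.stalk (τ x') ⧸ Ideal.span (Set.range c))] (M₀ : Submonoid K)
        [IsLocalization M₀ (X.presheaf.stalk (τ x') ⧸ Ideal.span (Set.range c))]
        (inst : Algebra (Polynomial K) (X'.presheaf.stalk x' ⧸ Ideal.span {(τ.stalkMap x').hom (c i), uf 0})),
        (∀ (g : K) (r : X.presheaf.stalk (τ x')), Ideal.Quotient.mk _ r = algebraMap K (X.presheaf.stalk (τ x') ⧸ Ideal.span (Set.range c)) g →
          algebraMap (Polynomial K) (X'.presheaf.stalk x' ⧸ Ideal.span {(τ.stalkMap x').hom (c i), uf 0}) (Polynomial.C g) =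
            Ideal.Quotient.mk _ ((τ.stalkMap x').hom r)) →
        algebraMap (Polynomial K) (X'.presheaf.stalk x' ⧸ Ideal.span {(τ.stalkMap x').hom (c i), uf 0}) Polynomial.X = Ideal.Quotient.mk _ (uf i₂) →
        ∃ N : Submonoid (Polynomial K), IsLocalization N (X'.presheaf.stalk x' ⧸ Ideal.span {(τ.stalkMap x').hom (c i), uf 0})) := by
  obtain ⟨i, uf, hrel, hufi, hloc, -, hX⟩ := exists_chart_localization_of_isBlowup hτ x' hR c Fin.elim0 hz hdim hcJ
  obtain ⟨hi0, ht'⟩ := uf_mem_maximalIdeal_of_mem_mul x' c hcJ i uf hrel 0 hL hJ0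
  have hnzd := stalkMap_mem_nonZeroDivisors_of_isBlowup hτ x' c hcJ i uf hrel
  -- the free index
  obtain ⟨i₂, hi₂0, hi₂i, huniq⟩ := fin_three_exists_third i hi0
  -- the chart ideal `(τ♯cᵢ, t′)` in the shape of ✓ `exists_chart_localization_of_isBlowup`
  have hK : Ideal.span {(τ.stalkMap x').hom (c i), uf 0} =
      Ideal.span {(τ.stalkMap x').hom (c i)} ⊔ Ideal.span ((fun j : {j : Fin 3 // j ≠ i} => uf j.1) '' {⟨0, hi0.symm⟩}) := by
    rw [Set.image_singleton, Ideal.span_insert]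
  refine ⟨i, i₂, uf, hi0, hi₂0, hi₂i, hrel, hufi, ht', hnzd, hloc _ _ hK (fun j hj => by rw [Set.mem_singleton_iff.mp hj]; exact ht'),
    fun K instK instA M₀ instM inst hKC hKX => ?_⟩
  have hi₂J : (⟨i₂, hi₂i⟩ : {j : Fin 3 // j ≠ i}) ∉ ({⟨0, hi0.symm⟩} : Set {j : Fin 3 // j ≠ i}) :=
    fun h => hi₂0 (congrArg Subtype.val (Set.mem_singleton_iff.mp h))
  have huniq' : ∀ j : {j : Fin 3 // j ≠ i}, j ∉ ({⟨0, hi0.symm⟩} : Set {j : Fin 3 // j ≠ i}) → j = ⟨i₂, hi₂i⟩ :=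
    fun j hj => Subtype.ext (huniq j.1 j.2 (fun h0 => hj (Set.mem_singleton_iff.mpr (Subtype.ext h0))))
  have hX1 := hX {⟨0, hi0.symm⟩} (Ideal.span {(τ.stalkMap x').hom (c i), uf 0}) hK ⟨i₂, hi₂i⟩ hi₂J huniq'
  exact @hX1 K instK instA M₀ instM inst hKC hKX

end Summit.ResolutionOfSingularities.ResolutionOfSingularities.Theorems.RadicialJung.CleanModels

end
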